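import Summits.ValiantsHypothesis.ValiantsHypothesis.Theorems.SymPencilEquivariantSdcNotQPFiniteConjugationLift
import HarnessLib

/-!
# ValiantsHypothesis / SymPencil — crux `EquivariantSdcNotQP` (stmt-ValiantsHypothesis-17792), line
# `birth_EquivariantSdcNotQP`: `stub_permify` from the permutation-embedding piece (iii′) ALONE

Composition of `permify_of_finiteLift_of_permEmbedding` (`…PermifyReduction.lean`) with the proof
of its hypothesis (ii′) `finiteConjugationLift` (`…FiniteConjugationLift.lean`): the registered
signature of `stub_permify` (Γ_n spelled out, as in the route statement) now follows from the single
representation-theoretic hypothesis (iii′) `PermEmbeddingQP` — every finite central extension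
`F ≤ (𝔖_n × 𝔖_n) × GL_{m₀}(ℂ)` of `𝔖_n × 𝔖_n` (scalar unimodular fibre) acting on `ℂ^{m₀}` is an
equivariant retract of a permutation `F`-set of size `2^{(log₂ m₀ + log₂ n + d)^d}` (Young's rule and
degree bounds for `𝔖_n × 𝔖_n` and its double covers; not in Mathlib).  That this file elaborates is
the kernel's check that (ii′) was proved with exactly the text the reduction consumes.
Helper of the item (`--supports stmt-ValiantsHypothesis-17792 --as helper`; 0 definitions / 0 facts).

Honest framing: `stub_permify` remains OPEN (it is now (iii′)); the crux `SymPencil.EquivariantSdcNotQP`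
and `VP ≠ VNP` remain OPEN and nothing here is progress on them.
-/

noncomputable section

set_option linter.dupNamespace false

namespace Summit.ValiantsHypothesis.ValiantsHypothesis.Theorems.SymPencilEquivariantSdcNotQP

open MvPolynomial Matrix Literature.Computability.AlgebraicComplexity

/-- **`stub_permify` ⇐ (iii′) `PermEmbeddingQP`.**  The line `birth_EquivariantSdcNotQP` of crux
17792 rests, after `stub_toSymmetricCircuit` (landed), steps (i), (ii′), (iv) of `stub_permify`
(landed), on this one hypothesis. [folklore] -/
theorem permify_of_permEmbedding
    (h₃ : ∃ d : ℕ, ∀ (n m₀ : ℕ)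
      (F : Subgroup ((Equiv.Perm (Fin n) × Equiv.Perm (Fin n)) × GL (Fin m₀) ℂ)),
      (∀ π ρ : Equiv.Perm (Fin n), ∃ g : GL (Fin m₀) ℂ, ((π, ρ), g) ∈ F) →
      (∀ g : GL (Fin m₀) ℂ, ((1 : Equiv.Perm (Fin n) × Equiv.Perm (Fin n)), g) ∈ F →
        ∃ c : ℂ, (g : Matrix (Fin m₀) (Fin m₀) ℂ) = c • (1 : Matrix (Fin m₀) (Fin m₀) ℂ)) →
      (∀ x ∈ F, Matrix.det (x.2 : Matrix (Fin m₀) (Fin m₀) ℂ) = 1) →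
      ∃ m' ≤ 2 ^ ((Nat.log 2 m₀ + Nat.log 2 n + d) ^ d),
        ∃ (ι : Matrix (Fin m') (Fin m₀) ℂ) (p : Matrix (Fin m₀) (Fin m') ℂ)
          (τ : (Equiv.Perm (Fin n) × Equiv.Perm (Fin n)) × GL (Fin m₀) ℂ → Equiv.Perm (Fin m')),
          p * ι = 1 ∧ ∀ x ∈ F,
            (τ x).permMatrix ℂ * ι = ι * (x.2 : Matrix (Fin m₀) (Fin m₀) ℂ) ∧
            p * (τ x).permMatrix ℂ = (x.2 : Matrix (Fin m₀) (Fin m₀) ℂ) * p) :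
    ∃ d : ℕ, ∀ (n m : ℕ) (A : Matrix (Fin m) (Fin m) (MvPolynomial (Fin n × Fin n) ℂ)),
      A.IsSymm → IsEquivariantDetRepr (Subgroup.closure {γ : GL (Fin n × Fin n) ℂ |
        ∃ π ρ : Equiv.Perm (Fin n), (γ : Matrix (Fin n × Fin n) (Fin n × Fin n) ℂ) =
          Equiv.Perm.permMatrix ℂ (Equiv.prodCongr π ρ)}) (perPoly (Fin n) ℂ) A →
      ∃ m' ≤ 2 ^ ((Nat.log 2 m + d) ^ d),
        ∃ A' : Matrix (Fin m') (Fin m') (MvPolynomial (Fin n × Fin n) ℂ),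
          IsAffineDetRepr (perPoly (Fin n) ℂ) A' ∧
          ∀ π ρ : Equiv.Perm (Fin n), ∃ σ : Equiv.Perm (Fin m'),
            A'.map (MvPolynomial.rename fun ij : Fin n × Fin n => (π ij.1, ρ ij.2)) =
              (σ.permMatrix ℂ).map MvPolynomial.C * A' * ((σ.permMatrix ℂ)ᵀ).map MvPolynomial.C :=
  permify_of_finiteLift_of_permEmbedding finiteConjugationLift h₃

end Summit.ValiantsHypothesis.ValiantsHypothesis.Theorems.SymPencilEquivariantSdcNotQP

end
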